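import Summits.RiemannHypothesis.RiemannHypothesis.Theorems.Splittings.NbBddNaturalThreeLines
import Summits.RiemannHypothesis.RiemannHypothesis.Theorems.Splittings.NbBddNaturalLineDecay
import Mathlib.Analysis.Complex.Hadamard
import HarnessLib

/-!
# Splittings — `liminf_N I(V_N) < ∞ ⟹ RH` for the natural Nyman–Beurling approximants
# (SPLIT-nb-neg gen 2, part 3/3: the label lemma by Hadamard three lines, and target T2)

Card `run/shared/lean/pub/rh-split/cards/SPLIT-nb-neg.md` §2 S8 asserted, with a proof SKETCH only, the «label
lemma»: boundedness of the Nyman–Beurling distance `I(V_N) = ∫⁻ ‖1-ζV_N‖²(1/2+it) dt/(1/4+t²)` of the NATURAL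
approximants `V_N(s) = Σ_{n≤N} μ(n)(1 - log n/log N) n^{-s}` along a subsequence already implies RH — so that in
a tail splitting of the crux `NbMoebiusMollifier` the finite conjunct is decoration and the tail is RH-strength.
This file PROVES it (no `sorry`, standard axioms), from parts 1/3 (test-function estimates) and 2/3 (line decay):

* `rh_of_nbBdd_of_line (K u) (hu : 2 ≤ u)` — **abstract label lemma**: if for every `ε > 0` there is a
  Dirichlet polynomial `A` with `I(A) ≤ K` AND `sup_t ‖1 - ζ(u+it)A(u+it)‖ ≤ ε`, then `RiemannHypothesis`.
  Proof: at an off-line zero `ρ` the test function `G_A(s) = (s-1-ζ₁(s)A(s))/(s²(s+1)²)` takes the FIXED value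
  `(ρ-1)/(ρ²(ρ+1)²) ≠ 0`; on `Re s = 1/2+η` it is `≤ √K/η`, on `Re s = u` it is `≤ ε`, and it is bounded on the
  strip; Hadamard's three-lines theorem (Mathlib
  `Complex.HadamardThreeLines.norm_le_interp_of_mem_verticalClosedStrip'`) gives `0 < c₀ ≤ (√K/η)^{1-τ} ε^τ`
  for every `ε` — contradiction.
* `rh_of_frequently_bdd_natural` — **T2 of the card, PROVED**: `(∃ᶠ N, I(V_N) ≤ C₁) → RiemannHypothesis`
  (integrand of `Theses.NymanBeurling.NbMoebiusMollifier` verbatim); corollaries `rh_of_natural_tailBdd`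
  (a bounded natural TAIL is RH-strength: in any tail splitting of `NbMoebiusMollifier` the finite conjunct is
  decoration) and the dichotomy `rh_or_tendsto_natural_atTop` (`RH ∨ I(V_N) → ∞`).

* `threeLines_floor_of_zero` / `natural_floor_of_zero` (appended, T3) — the RH-free core: at a zero `ρ` with
  `1/2 < Re ρ < 1`, `‖(ρ-1)/(ρ²(ρ+1)²)‖ ≤ (√K/η)^{1-τ} ε^τ` for every `A` with `I(A) ≤ K` and line-`u` error `ε`; for the
  natural approximants (`u = 3`, `ε = C/log N + Σ_{k>N} k⁻²`) an unconditional `I(V_N) ≫_ρ (log N)^{2τ/(1-τ)}` off RH.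

Relation to the tree: strengthens `riemannHypothesis_of_nbMoebiusMollifier` (needs `I(V_N) → 0` along a
subsequence) to `liminf I(V_N) < ∞`.  Nearest print: the lower bounds `d_N² ≥ c/log N` of
Báez-Duarte–Balazard–Landreau–Saias (2000) and Burnol (2002) concern ALL length-`N` polynomials and do not give
«bounded ⟹ RH»; the three-lines route at a general point is the delta (card gen-2 addendum, search log).  The
converse («RH ⟹ I(V_N) bounded») is OPEN; as a conjunct of a splitting the statement is therefore decoration BY
THEOREM (referee label below).

Provenance: cell rh-split, seat rh-split-nb-neg g2, zero-definition raw form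
`HOME/rh-split-nb-neg/NbBddNaturalRaw.lean` (sha16 4786d65a4b4f27e0, 720 lines; proofs verbatim), split in
three files (≤ 400 lines each: `NbBddNaturalThreeLines` test-function estimates / `NbBddNaturalLineDecay`
arithmetic input / `NbBddNatural` label lemma + target T2) and filed by rh-split-typer-1 g2 on the lead's GO
2026-08-26T19:39Z (HANDOFF-list item 1).  Referee (rh-split-ref g0) addendum 19:34Z on cards/SPLIT-nb-neg.md:
label lemma replayed std; «(A) three-lines criterion and (B) natural line decay checked on paper;
bddNaturalCriterion = liminf I(V_N) < ∞ ⟹ RH, converse open ⇒ decoration as a conjunct, by theorem»; class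
UNCHANGED (barrier-note).  Typer-1 g2 replay 20:02Z of the 720-line raw form: farm rc 0, 0 warnings, 0 sorry,
`#print axioms rh_of_frequently_bdd_natural` = [propext, Classical.choice, Quot.sound].

HONEST LABEL: «SPLITTING SEARCH over kernel-typed RH-EQUIVALENCES; a splitting A ∧ B ⟹ RH is
CONDITIONAL bookkeeping unless A and B are both proved; nothing here bears on the truth of RH.»
-/

set_option linter.dupNamespace false

noncomputable section

open Complex MeasureTheory Set Filter Topology
open scoped Real ENNReal

namespace Summit.RiemannHypothesis.RiemannHypothesis.Theorems.Splittings.NbBddNatural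

open Literature.NumberTheory.LFunctions
open Summit.RiemannHypothesis.RiemannHypothesis.Theses.NymanBeurling
open Summit.RiemannHypothesis.RiemannHypothesis.Theorems
open Complex.HadamardThreeLines

/-! ## The label lemma -/

/-- **Label lemma, abstract form (rh-split nb/neg, card §2 S8).** If there is `K` such that for every
`ε > 0` some Dirichlet polynomial `A(s) = Σ_{n<N} a_n (n+1)^{-s}` has BOUNDED Nyman–Beurling distance
`∫⁻ ‖1-ζ(1/2+it)A(1/2+it)‖² dt/(1/4+t²) ≤ K` and inverts `ζ` on the line `Re s = 2` to within `ε`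
(more generally on a line `Re s = u ≥ 2`: `‖1-ζ(u+it)A(u+it)‖ ≤ ε` for all `t`), then the Riemann
hypothesis holds.  (Beurling's easy half needs the distance `→ 0`; here boundedness suffices, the
decay being supplied on a line of absolute convergence — Hadamard three lines between `Re s = 1/2+η`
and `Re s = u`.) [folklore technique; statement not located in print — see the card] -/
theorem rh_of_nbBdd_of_line (K u : ℝ) (hu : 2 ≤ u)
    (h : ∀ ε : ℝ, 0 < ε → ∃ (N : ℕ) (a : Fin N → ℂ),
      (∫⁻ t : ℝ, ENNReal.ofReal (‖1 - riemannZeta (1 / 2 + t * Complex.I) *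
        ∑ n : Fin N, a n * ((n : ℂ) + 1) ^ (-(1 / 2 + t * Complex.I))‖ ^ 2 / (1 / 4 + t ^ 2)) ≤
        ENNReal.ofReal K) ∧
      ∀ t : ℝ, ‖1 - riemannZeta (u + t * Complex.I) *
        ∑ n : Fin N, a n * ((n : ℂ) + 1) ^ (-(u + t * Complex.I))‖ ≤ ε) :
    RiemannHypothesis := by
  set K' : ℝ := max K 0 with hK'
  have hK'0 : 0 ≤ K' := le_max_right _ _
  refine quasiRiemannHypothesis_one_half_iff_holds.mp fun ρ hζ hρ hρ1 ↦ ?_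
  -- the off-line zero `ρ`: `1/2 < Re ρ < 1`
  have hρne1 : ρ ≠ 1 := by intro e; rw [e] at hρ1; simp at hρ1
  have hρ0 : ρ ≠ 0 := by intro e; rw [e] at hρ; simp at hρ; linarith
  have hρm1 : ρ + 1 ≠ 0 := by
    intro e
    have : (ρ + 1).re = 0 := by rw [e]; simp
    simp at this; linarith
  -- strip `[l, u]`, `l = 1/2 + η`, `η = (Re ρ - 1/2)/2`, exponent `τ`
  set η : ℝ := (ρ.re - 1 / 2) / 2 with hη
  have hη0 : 0 < η := by rw [hη]; linarith
  set l : ℝ := 1 / 2 + η with hl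
  have hl2 : l < u := by rw [hl, hη]; linarith
  have hlρ : l < ρ.re := by rw [hl, hη]; linarith
  set τ : ℝ := (ρ.re - l) / (u - l) with hτ
  have hτ0 : 0 < τ := div_pos (by linarith) (by linarith)
  -- the fixed value at `ρ`
  set c₀ : ℝ := ‖(ρ - 1) / (ρ ^ 2 * (ρ + 1) ^ 2)‖ with hc₀
  have hc₀0 : 0 < c₀ := norm_pos_iff.mpr (div_ne_zero (sub_ne_zero.mpr hρne1)
    (mul_ne_zero (pow_ne_zero 2 hρ0) (pow_ne_zero 2 hρm1)))
  -- the line-`l` constant and the choice of `ε`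
  set A₀ : ℝ := (Real.sqrt K' / η) ^ (1 - τ) with hA₀
  have hA₀0 : 0 ≤ A₀ := Real.rpow_nonneg (div_nonneg (Real.sqrt_nonneg _) hη0.le) _
  have hq : 0 < c₀ / (2 * (A₀ + 1)) := by positivity
  set ε : ℝ := (c₀ / (2 * (A₀ + 1))) ^ τ⁻¹ with hε
  have hε0 : 0 < ε := Real.rpow_pos_of_pos hq _
  have hετ : ε ^ τ = c₀ / (2 * (A₀ + 1)) := by rw [hε, Real.rpow_inv_rpow hq.le hτ0.ne']
  obtain ⟨N, a, hI, hline⟩ := h ε hε0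
  set G : ℂ → ℂ := fun s ↦ (s - 1 - riemannZeta₁ s * dirichletPoly a s) / (s ^ 2 * (s + 1) ^ 2) with hGdef
  have hG : ∀ s, G s = (s - 1 - riemannZeta₁ s * dirichletPoly a s) / (s ^ 2 * (s + 1) ^ 2) :=
    fun s ↦ rfl
  have hI' : (∫⁻ t : ℝ, ENNReal.ofReal (‖1 - riemannZeta (1 / 2 + t * Complex.I) *
        ∑ n : Fin N, a n * ((n : ℂ) + 1) ^ (-(1 / 2 + t * Complex.I))‖ ^ 2 / (1 / 4 + t ^ 2))) ≤
      ENNReal.ofReal K' := hI.trans (ENNReal.ofReal_le_ofReal (le_max_left _ _))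
  -- hypotheses of the three-lines theorem for `G_a` on `[l, u]`
  have hz : ρ ∈ verticalClosedStrip l u := by
    simp only [verticalClosedStrip, mem_preimage, mem_Icc]
    exact ⟨hlρ.le, by linarith⟩
  have hcl : closure (verticalStrip l u) ⊆ {s : ℂ | 0 < s.re} := by
    rw [verticalStrip, closure_preimage_re, closure_Ioo hl2.ne]
    intro z hz'
    simp only [mem_preimage, mem_Icc] at hz'
    show 0 < z.re
    have : 0 < l := by rw [hl]; linarith
    linarith [hz'.1]
  have hd : DiffContOnCl ℂ G (verticalStrip l u) :=
    ((differentiableOn_nbG a hG).mono hcl).diffContOnCl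
  have hB : BddAbove ((norm ∘ G) '' verticalClosedStrip l u) := by
    refine ⟨6 + 8 * ∑ n : Fin N, ‖a n‖, ?_⟩
    rintro _ ⟨z, hz', rfl⟩
    simp only [verticalClosedStrip, mem_preimage, mem_Icc] at hz'
    have : 0 < l := by rw [hl]; linarith
    exact norm_nbG_le_of_half_le_re a hG (by linarith [hz'.1])
  have ha : ∀ z ∈ re ⁻¹' ({l} : Set ℝ), ‖G z‖ ≤ Real.sqrt K' / η := by
    intro z hz'
    have hzre : z.re = l := hz'
    have hz2 : 1 / 2 < z.re := by rw [hzre, hl]; linarith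
    have := norm_nbG_le_of_re hz2 a hG hK'0 hI'
    rwa [hzre, hl, show 1 / 2 + η - 1 / 2 = η by ring] at this
  have hb : ∀ z ∈ re ⁻¹' ({u} : Set ℝ), ‖G z‖ ≤ ε := by
    intro z hz'
    have hzre : z.re = u := hz'
    have hz' : z = u + (z.im : ℂ) * Complex.I := by
      apply Complex.ext <;> simp [hzre]
    refine (norm_nbG_le_of_two_le_re a hG (by rw [hzre]; exact hu)).trans ?_
    rw [dirichletPoly_apply, hz']
    exact hline z.im
  -- three lines
  have h3 := norm_le_interp_of_mem_verticalClosedStrip' (f := G) hl2 hz hd hB ha hb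
  rw [← hτ, ← hA₀, hετ, nbG_apply_zero hζ hρne1 a hG, ← hc₀] at h3
  -- `c₀ ≤ A₀ c₀ / (2(A₀+1)) < c₀`
  have : A₀ * (c₀ / (2 * (A₀ + 1))) < c₀ := by
    rw [← mul_div_assoc, div_lt_iff₀ (by positivity)]
    nlinarith
  linarith

/-! ## Target T2 of the card — `liminf_N I(V_N) < ∞ ⟹ RH` -/

/-- **T2.** If the Nyman–Beurling distances `I(V_N)` of the NATURAL approximants
`V_N(s) = Σ_{n≤N} μ(n)(1 - log n/log N) n^{-s}` (integrand of the crux `NbMoebiusMollifier` verbatim) are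
bounded along a subsequence, the Riemann hypothesis holds: a frequently-bounded `I(V_N)` meets the
eventual line-`3` decay (`natural_lineDecay_three`) at some `N`, and the abstract label lemma
`rh_of_nbBdd_of_line` applies.  Strengthens the tree's easy half
`riemannHypothesis_of_nbMoebiusMollifier` (which needs `I(V_N) → 0` along a subsequence). -/
theorem rh_of_frequently_bdd_natural (C₁ : ℝ)
    (h : ∃ᶠ N : ℕ in atTop, ∫⁻ t : ℝ, ENNReal.ofReal (‖1 - riemannZeta (1 / 2 + t * Complex.I) *
      ∑ n : Fin N, ((ArithmeticFunction.moebius (n + 1) : ℝ) *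
        (1 - Real.log ((n : ℝ) + 1) / Real.log N) : ℂ) * ((n : ℂ) + 1) ^ (-(1 / 2 + t * Complex.I))‖ ^ 2 /
          (1 / 4 + t ^ 2)) ≤ ENNReal.ofReal C₁) :
    RiemannHypothesis := by
  refine rh_of_nbBdd_of_line C₁ 3 (by norm_num) fun ε hε ↦ ?_
  obtain ⟨N, hN1, hN2⟩ := (h.and_eventually (natural_lineDecay_three ε hε)).exists
  exact ⟨N, fun n : Fin N ↦ ((ArithmeticFunction.moebius (n + 1) : ℝ) *
    (1 - Real.log ((n : ℝ) + 1) / Real.log N) : ℂ), hN1, hN2⟩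

/-- Hence a bounded natural TAIL «`I(V_N) ≤ C₁` for all `N ≥ H`» is RH-STRENGTH on its own,
unconditionally: in any tail splitting of `NbMoebiusMollifier` the finite conjunct `N ≤ H` is
decoration (card §2 S8 / §3 M2-natural — now a kernel theorem, not a heuristic). -/
theorem rh_of_natural_tailBdd (C₁ : ℝ) (H : ℕ)
    (hB : ∀ N : ℕ, H ≤ N → ∫⁻ t : ℝ, ENNReal.ofReal (‖1 - riemannZeta (1 / 2 + t * Complex.I) *
      ∑ n : Fin N, ((ArithmeticFunction.moebius (n + 1) : ℝ) *
        (1 - Real.log ((n : ℝ) + 1) / Real.log N) : ℂ) * ((n : ℂ) + 1) ^ (-(1 / 2 + t * Complex.I))‖ ^ 2 /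
          (1 / 4 + t ^ 2)) ≤ ENNReal.ofReal C₁) :
    RiemannHypothesis :=
  rh_of_frequently_bdd_natural C₁
    (frequently_atTop.2 fun N ↦ ⟨max N H, le_max_left _ _, hB _ (le_max_right _ _)⟩)

/-- The dichotomy form: either RH, or `I(V_N) → ∞`. -/
theorem rh_or_tendsto_natural_atTop :
    RiemannHypothesis ∨ Tendsto (fun N : ℕ ↦ ∫⁻ t : ℝ, ENNReal.ofReal (‖1 - riemannZeta (1 / 2 + t * Complex.I) *
      ∑ n : Fin N, ((ArithmeticFunction.moebius (n + 1) : ℝ) *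
        (1 - Real.log ((n : ℝ) + 1) / Real.log N) : ℂ) * ((n : ℂ) + 1) ^ (-(1 / 2 + t * Complex.I))‖ ^ 2 /
          (1 / 4 + t ^ 2))) atTop (𝓝 ∞) := by
  by_cases hT : Tendsto (fun N : ℕ ↦ ∫⁻ t : ℝ, ENNReal.ofReal (‖1 - riemannZeta (1 / 2 + t * Complex.I) *
      ∑ n : Fin N, ((ArithmeticFunction.moebius (n + 1) : ℝ) *
        (1 - Real.log ((n : ℝ) + 1) / Real.log N) : ℂ) * ((n : ℂ) + 1) ^ (-(1 / 2 + t * Complex.I))‖ ^ 2 /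
          (1 / 4 + t ^ 2))) atTop (𝓝 ∞)
  · exact Or.inr hT
  · left
    rw [ENNReal.tendsto_nhds_top_iff_nnreal] at hT
    push Not at hT
    obtain ⟨x, hx⟩ := hT
    refine rh_of_frequently_bdd_natural x ?_
    refine hx.mono fun N hN ↦ ?_
    rwa [ENNReal.ofReal_coe_nnreal]


/-! ## RH-free floors (SPLIT-nb-neg gen 2, T3): the three-lines inequality at an off-line zero, unconditionally

Appended 2026-08-26 by rh-split-typer-1 g2 from the seat's final raw form `HOME/rh-split-nb-neg/NbBddNaturalRaw.lean`
(sha16 d008690990844c0a, 787 lines; proofs verbatim; referee PRE-FILE PASS 20:41Z, lead HANDOFF-list option (α)).  The label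
lemma above runs the same three-lines argument by contradiction; here the inequality itself is recorded, so that an
off-line zero gives an EFFECTIVE divergence `I(V_N) ≫_ρ (log N)^{2τ/(1-τ)}` of the natural Nyman–Beurling distance. -/

/-- **THREE-LINES FLOOR** — the RH-free core of the label lemma.  Let `ρ` be a zero of `ζ` with
`1/2 < Re ρ < 1`; put `η := (Re ρ - 1/2)/2`, `l := 1/2 + η`, and for `u ≥ 2`, `τ := (Re ρ - l)/(u - l)`.
For every Dirichlet polynomial `A_a` with `I(A_a) ≤ K` (`0 ≤ K`) and `‖1 - ζ(u+it)A_a(u+it)‖ ≤ ε` for all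
`t`: `‖(ρ-1)/(ρ²(ρ+1)²)‖ ≤ (√K/η)^{1-τ} · ε^τ` (Hadamard three lines for the test function of part 1/3 (`NbBddNaturalThreeLines.lean`) on
the strip `[l, u]`).  Vacuous under RH; unconditional as stated. -/
theorem threeLines_floor_of_zero {ρ : ℂ} (hζ : riemannZeta ρ = 0) (hρ : 1 / 2 < ρ.re) (hρ1 : ρ.re < 1)
    {K u ε : ℝ} (hK : 0 ≤ K) (hu : 2 ≤ u) {N : ℕ} (a : Fin N → ℂ)
    (hI : (∫⁻ t : ℝ, ENNReal.ofReal (‖1 - riemannZeta (1 / 2 + t * Complex.I) *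
        ∑ n : Fin N, a n * ((n : ℂ) + 1) ^ (-(1 / 2 + t * Complex.I))‖ ^ 2 / (1 / 4 + t ^ 2))) ≤
      ENNReal.ofReal K)
    (hline : ∀ t : ℝ, ‖1 - riemannZeta (u + t * Complex.I) *
        ∑ n : Fin N, a n * ((n : ℂ) + 1) ^ (-(u + t * Complex.I))‖ ≤ ε) :
    ‖(ρ - 1) / (ρ ^ 2 * (ρ + 1) ^ 2)‖ ≤
      (Real.sqrt K / ((ρ.re - 1 / 2) / 2)) ^
          (1 - (ρ.re - (1 / 2 + (ρ.re - 1 / 2) / 2)) / (u - (1 / 2 + (ρ.re - 1 / 2) / 2))) *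
        ε ^ ((ρ.re - (1 / 2 + (ρ.re - 1 / 2) / 2)) / (u - (1 / 2 + (ρ.re - 1 / 2) / 2))) := by
  have hρne1 : ρ ≠ 1 := by intro e; rw [e] at hρ1; simp at hρ1
  -- strip `[l, u]`, `l = 1/2 + η`, `η = (Re ρ - 1/2)/2`, exponent `τ`
  set η : ℝ := (ρ.re - 1 / 2) / 2 with hη
  have hη0 : 0 < η := by rw [hη]; linarith
  set l : ℝ := 1 / 2 + η with hl
  have hl2 : l < u := by rw [hl, hη]; linarith
  have hlρ : l < ρ.re := by rw [hl, hη]; linarith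
  set τ : ℝ := (ρ.re - l) / (u - l) with hτ
  -- the test function
  set G : ℂ → ℂ := fun s ↦ (s - 1 - riemannZeta₁ s * dirichletPoly a s) / (s ^ 2 * (s + 1) ^ 2) with hGdef
  have hG : ∀ s, G s = (s - 1 - riemannZeta₁ s * dirichletPoly a s) / (s ^ 2 * (s + 1) ^ 2) :=
    fun s ↦ rfl
  -- hypotheses of the three-lines theorem for `G` on `[l, u]`
  have hz : ρ ∈ verticalClosedStrip l u := by
    simp only [verticalClosedStrip, mem_preimage, mem_Icc]
    exact ⟨hlρ.le, by linarith⟩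
  have hcl : closure (verticalStrip l u) ⊆ {s : ℂ | 0 < s.re} := by
    rw [verticalStrip, closure_preimage_re, closure_Ioo hl2.ne]
    intro z hz'
    simp only [mem_preimage, mem_Icc] at hz'
    show 0 < z.re
    have : 0 < l := by rw [hl]; linarith
    linarith [hz'.1]
  have hd : DiffContOnCl ℂ G (verticalStrip l u) :=
    ((differentiableOn_nbG a hG).mono hcl).diffContOnCl
  have hB : BddAbove ((norm ∘ G) '' verticalClosedStrip l u) := by
    refine ⟨6 + 8 * ∑ n : Fin N, ‖a n‖, ?_⟩
    rintro _ ⟨z, hz', rfl⟩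
    simp only [verticalClosedStrip, mem_preimage, mem_Icc] at hz'
    have : 0 < l := by rw [hl]; linarith
    exact norm_nbG_le_of_half_le_re a hG (by linarith [hz'.1])
  have ha : ∀ z ∈ re ⁻¹' ({l} : Set ℝ), ‖G z‖ ≤ Real.sqrt K / η := by
    intro z hz'
    have hzre : z.re = l := hz'
    have hz2 : 1 / 2 < z.re := by rw [hzre, hl]; linarith
    have := norm_nbG_le_of_re hz2 a hG hK hI
    rwa [hzre, hl, show 1 / 2 + η - 1 / 2 = η by ring] at this
  have hb : ∀ z ∈ re ⁻¹' ({u} : Set ℝ), ‖G z‖ ≤ ε := by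
    intro z hz'
    have hzre : z.re = u := hz'
    have hz' : z = u + (z.im : ℂ) * Complex.I := by
      apply Complex.ext <;> simp [hzre]
    refine (norm_nbG_le_of_two_le_re a hG (by rw [hzre]; exact hu)).trans ?_
    rw [dirichletPoly_apply, hz']
    exact hline z.im
  -- three lines
  have h3 := norm_le_interp_of_mem_verticalClosedStrip' (f := G) hl2 hz hd hB ha hb
  rw [← hτ, nbG_apply_zero hζ hρne1 a hG] at h3
  exact h3

/-- **T3 — EFFECTIVE NATURAL FLOOR (RH-free, unconditional as stated).**  An off-line zero `ρ`
(`1/2 < Re ρ < 1`) forces, for EVERY `N ≥ 2` and every `K ≥ 0` with `I(V_N) ≤ K`: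
`‖(ρ-1)/(ρ²(ρ+1)²)‖ ≤ (√K/η)^{1-τ} · (C/log N + Σ_{k>N} k⁻²)^τ` with `η = (Re ρ-1/2)/2`, `l = 1/2+η`,
`τ = (Re ρ - l)/(3 - l)`, `C = Σ_k k⁻²` — i.e. `I(V_N) ≫_ρ (log N)^{2τ/(1-τ)}`: an unconditional
log-power divergence of the natural Nyman–Beurling distance off RH (print has the conditional
`N^{2σ₀-1}/log²N` asymptotic of Maier–Rassias under «exactly one off-line quadruplet» + a `|ζ'(ρ)|⁻²`
growth hypothesis). -/
theorem natural_floor_of_zero {ρ : ℂ} (hζ : riemannZeta ρ = 0) (hρ : 1 / 2 < ρ.re) (hρ1 : ρ.re < 1)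
    {N : ℕ} (hN : 2 ≤ N) {K : ℝ} (hK : 0 ≤ K)
    (hI : ∫⁻ t : ℝ, ENNReal.ofReal (‖1 - riemannZeta (1 / 2 + t * Complex.I) *
      ∑ n : Fin N, ((ArithmeticFunction.moebius (n + 1) : ℝ) *
        (1 - Real.log ((n : ℝ) + 1) / Real.log N) : ℂ) * ((n : ℂ) + 1) ^ (-(1 / 2 + t * Complex.I))‖ ^ 2 /
          (1 / 4 + t ^ 2)) ≤ ENNReal.ofReal K) :
    ‖(ρ - 1) / (ρ ^ 2 * (ρ + 1) ^ 2)‖ ≤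
      (Real.sqrt K / ((ρ.re - 1 / 2) / 2)) ^
          (1 - (ρ.re - (1 / 2 + (ρ.re - 1 / 2) / 2)) / ((3 : ℝ) - (1 / 2 + (ρ.re - 1 / 2) / 2))) *
        ((Real.log N)⁻¹ * (∑' k : ℕ, 1 / (k : ℝ) ^ 2) + ∑' k : ℕ, 1 / ((k + (N + 1) : ℕ) : ℝ) ^ 2) ^
          ((ρ.re - (1 / 2 + (ρ.re - 1 / 2) / 2)) / ((3 : ℝ) - (1 / 2 + (ρ.re - 1 / 2) / 2))) := by
  have hw : ∀ n : ℕ, (fun n : ℕ ↦ if n ≤ N then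
      (((ArithmeticFunction.moebius n : ℝ) * (1 - Real.log n / Real.log N) : ℝ) : ℂ) else 0) n =
      if n ≤ N then (((ArithmeticFunction.moebius n : ℝ) * (1 - Real.log n / Real.log N) : ℝ) : ℂ)
      else 0 := fun n ↦ rfl
  have hline : ∀ t : ℝ, ‖1 - riemannZeta ((3 : ℝ) + t * Complex.I) * ∑ n : Fin N,
      ((ArithmeticFunction.moebius (n + 1) : ℝ) * (1 - Real.log ((n : ℝ) + 1) / Real.log N) : ℂ) *
        ((n : ℂ) + 1) ^ (-((3 : ℝ) + t * Complex.I))‖ ≤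
      (Real.log N)⁻¹ * (∑' k : ℕ, 1 / (k : ℝ) ^ 2) + ∑' k : ℕ, 1 / ((k + (N + 1) : ℕ) : ℝ) ^ 2 := by
    intro t
    rw [norm_sub_rev, VN_eq_LSeries hw]
    exact norm_zeta_mul_VN_sub_one_le hw hN t
  exact threeLines_floor_of_zero hζ hρ hρ1 hK (by norm_num) _ hI hline

end Summit.RiemannHypothesis.RiemannHypothesis.Theorems.Splittings.NbBddNatural

end
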